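import Mathlib.NumberTheory.PrimeCounting
import Mathlib.Analysis.SpecialFunctions.Log.Basic
import Mathlib.Analysis.SpecialFunctions.Exp
import HarnessLib

/-!
# Rosser–Schoenfeld 1962, Theorem 2: `x/(log x − ½) < π(x)` (`x ≥ 67`) and `π(x) < x/(log x − 3/2)` (`x > e^{3/2}`)

J. B. Rosser, L. Schoenfeld, *Approximate formulas for some functions of prime numbers*, Illinois J. Math. 6 (1962)
64–94, §3, p. 69 (materialised: `paper:doi-10-1215-ijm-1255631807`, p. 6 of the PDF):

> THEOREM 1. (3.1) `x/log x · (1 + 1/(2 log x)) < π(x)` for `59 ≤ x`; (3.2) `π(x) < x/log x · (1 + 3/(2 log x))` for `1 < x`.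
> THEOREM 2. (3.3) `x/(log x − 1/2) < π(x)` for `67 ≤ x`; (3.4) `π(x) < x/(log x − 3/2)` for `e^{3/2} < x`.
> COROLLARY 1. (3.5) `x/log x < π(x)` for `17 ≤ x`; (3.6) `π(x) < 1.25506 x/log x` for `1 < x`.

The tree's Rosser–Schoenfeld layer (`RosserSchoenfeldMertens*`, `RosserSchoenfeldEq3*`, `SchoenfeldPsiTheta`) covers §3's `θ`, `ψ`
and Mertens-type statements (3.14)–(3.30) but not the `π(x)` bounds; this file vendors **Theorem 2** as ONE named fact
(`RosserSchoenfeld1962_theorem2`, both displays) with the two displays as proved projections — the lower bound (3.3) is the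
all-`x` input of the cell's explicit uniform Romanoff count (`π(x) > x/(log x − ½)`, `x ≥ 67`).  `π(x)` for real `x` is
`Nat.primeCounting ⌊x⌋₊`.  The proof in the source rests on the zero-free region and the verified zeros of `ζ` of its §§4–6;
not reproduced here (a kernel certificate for a bounded range plus an explicit `θ` input would discharge it — cf. the tree's
`Dusart2010_theta_thm_5_2` programme).

## References
* J. B. Rosser, L. Schoenfeld, Illinois J. Math. 6 (1962) 64–94, Theorem 2, eqs. (3.3)–(3.4), p. 69. [RosserSchoenfeld1962]
-/

namespace Literature.NumberTheory.LFunctions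

/-- **Rosser–Schoenfeld 1962, Theorem 2** (p. 69): (3.3) `x/(log x − 1/2) < π(x)` for `67 ≤ x`, and (3.4)
`π(x) < x/(log x − 3/2)` for `e^{3/2} < x` (here `π(x) = π(⌊x⌋)`). [cite: RosserSchoenfeld1962, Theorem 2, eqs. (3.3)-(3.4), p. 69] -/
def RosserSchoenfeld1962_theorem2 : Prop :=
  (∀ x : ℝ, 67 ≤ x → x / (Real.log x - 1 / 2) < (Nat.primeCounting ⌊x⌋₊ : ℝ)) ∧
    (∀ x : ℝ, Real.exp (3 / 2) < x → (Nat.primeCounting ⌊x⌋₊ : ℝ) < x / (Real.log x - 3 / 2))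

/-- (3.3): `x/(log x − 1/2) < π(x)` for `x ≥ 67`, from Theorem 2. [cite: RosserSchoenfeld1962, Theorem 2, eq. (3.3)] -/
theorem RosserSchoenfeld1962_eq_3_3_of (h : RosserSchoenfeld1962_theorem2) {x : ℝ} (hx : 67 ≤ x) :
    x / (Real.log x - 1 / 2) < (Nat.primeCounting ⌊x⌋₊ : ℝ) :=
  h.1 x hx

/-- (3.4): `π(x) < x/(log x − 3/2)` for `x > e^{3/2}`, from Theorem 2. [cite: RosserSchoenfeld1962, Theorem 2, eq. (3.4)] -/
theorem RosserSchoenfeld1962_eq_3_4_of (h : RosserSchoenfeld1962_theorem2) {x : ℝ} (hx : Real.exp (3 / 2) < x) :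
    (Nat.primeCounting ⌊x⌋₊ : ℝ) < x / (Real.log x - 3 / 2) :=
  h.2 x hx

/-- (3.3) at an integer: `n/(log n − 1/2) < π(n)` for `n ≥ 67`. [cite: RosserSchoenfeld1962, Theorem 2, eq. (3.3)] -/
theorem RosserSchoenfeld1962_eq_3_3_nat_of (h : RosserSchoenfeld1962_theorem2) {n : ℕ} (hn : 67 ≤ n) :
    (n : ℝ) / (Real.log n - 1 / 2) < (Nat.primeCounting n : ℝ) := by
  have := h.1 (n : ℝ) (by exact_mod_cast hn)
  rwa [Nat.floor_natCast] at this

end Literature.NumberTheory.LFunctions
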